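import Mathlib.Analysis.SpecialFunctions.Pow.Real
import Literature.MathematicalPhysics.QuantumFieldTheory.BalabanImbrieJaffe1984to88.BIJ88ElementaryRegions304

/-!
# `BalabanImbrieJaffe1984to88.BIJ88SmallPowerPerCube307` — T. Bałaban, J. Imbrie, A. Jaffe, *Effective action and cluster properties of
the abelian Higgs model*, Commun. Math. Phys. **114** (1988) 257–315 [BalabanImbrieJaffe1988]: Sect. 5.13, p. 307 — the COMBINATORIAL
CORE of the decoupling estimate: *"a small power of e^β(L^kε/ε₀)^{1/4−α} in every cube of X_α"* except the exceptional cubes and one cube,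
PROVED for the elementary regions `□_i` of `BIJ88ElementaryRegions304` (the exponent β′ = 1/(c − 1), c = the maximal number of cubes of a
joining polymer — p. 303: *"Note that Y contains at most a few cubes"*).

HONEST FRAMING (cell `lit-balaban`, verbatim): statement-level skeleton of published theorems with citation tags; proofs where landed; nothing here is a claim about the Yang–Mills mass gap.

PDF held: `paper:balaban1988-cmp114-bij-abelian-higgs-effective-action` (journal page = PDF page + 256); p. 303 = PDF p. 47, p. 307 = PDF
p. 51 (renders `original-p047-x2.png`, `original-p051-x2.png` in the seat folder; materialised text `p0047.txt`, `p0051.txt`).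

CITATION HEADER (verbatim).  p. 303 [PDF 47]: *"We have an estimate |V^{(k)}(Y)| ≤ e^β(L^kε/ε₀)^{1/4−α}. Note that Y contains at most a
few cubes."*  p. 307 [PDF 51]: *"Let us estimate g₂(X_α) now. Each time some cubes are joined into one □_i by an e^{−V^{(k)}(Y)} − 1 or an
e^{−W₅^{(k)}(X)} − 1, we get a factor e^β(L^kε/ε₀)^{1/4−α} or e^{−cr(e_k)}. Each time some □_i's are joined, we have s-derivatives, which
produce functional derivatives, chains of covariances C_{ω(α)}, and factors ℱ = O(e^{−cr(e_k)}). … Altogether, we typically get at least a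
small power of e^β(L^kε/ε₀)^{1/4−α} in every cube of X_α. The exceptions are when cubes are in a component of Λ₁₁^{(k)c}, when they
support some F^{m̄}_{k,loc}(X_{σ₁}), or when X_α is a single cube. We must allow for divergent factors such as (L^kε)^{−m̃} at
F^{m̄}_{k,loc}(X_{σ₁}), where m̃ depends on F. … Such factors are easily beaten by the small factors described above for nonexceptional
cubes. For the cubes in Λ₁₁^{(k)c} or for a single cube, we have to include the proper volume factor in our final estimate. In sum, we have
the following bound or [sic] g₂(X_α): |g₂(X_α)| ≤ exp[(e^β(L^kε/ε₀)^{1/4−α})^{β′}(|X_α ∩ Λ₁₁^{(k)c}| + 1)] × Π_{σ₁}(L^kε)^{−m̃(σ₁)}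
(e^β(L^kε/ε₀)^{1/4−α})^{β′|X_α∖Λ₁₁^{(k)c}|}."*

WHAT IS REPRODUCED (unit `lit-balaban-p25`, generation 7 of the Phase-2 proof seat p25; SKELETON row `C2.Claim@307` — the bound itself is
the typed `Prop` leaf `BIJ88Sect5StatementsPart2.Ineq307` and is NOT derived here; companion of `BIJ88ElementaryRegions304` (row
`C2.Eq5.13.1-5.13.2`); HOME `run/shared/lean/pub/lit-balaban/lit-balaban-p25/`).  SETTING (that of `BIJ88ElementaryRegions304`): cubes
`W : Finset ι`, joining family `J` (rules (i)–(iv) of p. 304), elementary regions `region J W i`; a sub-family `J₁ ⊆ J` of SMALL-FACTOR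
joining sets (rules (i)/(ii): the `Y ∈ S_Y` with `|e^{−V(Y)} − 1| ≲ e^β(L^kε/ε₀)^{1/4−α}`, the `X ∈ S₅` with `e^{−cr(e_k)}`); the cubes of the
other joining sets (rules (iii)/(iv): near an `X_{σ₁}`, in a component of Λ₁₁^{(k)c}) are the EXCEPTIONAL cubes `(J ∖ J₁).biUnion id`.
§1 **`card_region_sdiff_le`** — the counting behind *"each time some cubes are joined … we get a factor"*: the non-exceptional cubes of
  `□_i` number at most `1 + Σ_{Y ∈ J₁ assigned to □_i} (|Y ∩ W| − 1)` (a breadth-first construction of `□_i` from its cube: every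
  small-factor joining set used adds at most `|Y ∩ W| − 1` new cubes, every other one adds only exceptional cubes); with *"Y contains at
  most"* `c` *"cubes"*: **`card_region_sdiff_le_mul`** `|□_i ∖ E| ≤ 1 + (c − 1)·N(□_i)`, `N(□_i)` = the number of small-factor joining
  sets assigned to `□_i` (as in `BIJ88ElementaryRegions304.prod_regroup`: those `Y` with `Y ∩ W ⊆ □_i`); `card_region_le_mul` (no
  exceptional sets).
§2 **`abs_prod_assigned_le_pow`** / **`abs_prod_assigned_le_rpow`** — *"at least a small power of [θ] in every cube of X_α. The exceptions
  are … or when X_α is a single cube"*: if every small-factor joining set carries a factor of modulus `≤ θ ≤ 1`, the product of the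
  factors assigned to `□_i` is at most `θ^{N(□_i)} ≤ θ^{(|□_i ∖ E| − 1)/(c − 1)}`, i.e. a power `β′ = 1/(c − 1)` of `θ` per non-exceptional
  cube but one; versions `…_of_mem_regions` over `P ∈ regions J W`.
READINGS (declared): (a) the two printed small factors e^β(L^kε/ε₀)^{1/4−α} and e^{−cr(e_k)} are bounded by one `θ ∈ (0,1]`; (b) the joins
BETWEEN different □_i (s-derivatives, factors ℱ = O(e^{−cr(e_k)}), walks, the arguments of [3] Sect. 14 and [9]) are not modelled — as in
`BIJ88ElementaryRegions304` §4–§5 the statement is per elementary region (a two-cube joining set with a small factor is, abstractly, covered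
by the same count); (c) the "−1" is the printed single-cube exception / volume factor; the printed prefactor exp[θ^{β′}(|X_α ∩ Λ₁₁ᶜ| + 1)]
and the divergent factors (L^kε)^{−m̃(σ₁)} concern the exceptional cubes and are outside this count.  Finite combinatorics and one real
inequality; 0 `sorry`, 0 new `Prop` facts, no new definitions.
-/

open Finset
open Literature.MathematicalPhysics.QuantumFieldTheory.BalabanImbrieJaffe1984to88.BIJ88ElementaryRegions304 (IsClosed region regions
  region_subset mem_region_self isClosed_region region_connected mem_regions)

namespace Literature.MathematicalPhysics.QuantumFieldTheory.BalabanImbrieJaffe1984to88.BIJ88SmallPowerPerCube307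

variable {ι : Type*} [DecidableEq ι]

/-! ## §1 Counting the joins: the non-exceptional cubes of an elementary region -/

/-- **p. 307** [PDF 51], verbatim: *"Each time some cubes are joined into one □_i by an e^{−V^{(k)}(Y)} − 1 or an e^{−W₅^{(k)}(X)} − 1, we get
a factor e^β(L^kε/ε₀)^{1/4−α} or e^{−cr(e_k)}."* — THE COUNT: for the joining family `J`, a sub-family `J₁ ⊆ J` (the joining sets carrying a
small factor) and the exceptional cubes `E = ⋃ (J ∖ J₁)` (the cubes of the other joining sets), the elementary region `□_i` of a cube
`i ∈ W` has at most `1 + Σ_{Y ∈ J₁, Y ∩ W ⊆ □_i} (|Y ∩ W| − 1)` non-exceptional cubes: growing `□_i` from `{i}` one joining set at a time,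
a small-factor set `Y` adds at most `|Y ∩ W| − 1` new cubes (it already meets the set built so far) and any other joining set adds
exceptional cubes only. [cite: BalabanImbrieJaffe1988, p.307 (Sect. 5.13)] -/
theorem card_region_sdiff_le (J J₁ : Finset (Finset ι)) (W : Finset ι) {i : ι} (hi : i ∈ W) :
    ((region J W i) \ (J \ J₁).biUnion id).card ≤
      1 + ∑ Y ∈ J₁.filter (fun Y => Y ∩ W ⊆ region J W i), ((Y ∩ W).card - 1) := by
  set Q := region J W i with hQdef
  set E := (J \ J₁).biUnion id with hEdef
  -- the invariant-carrying claim, by strong induction on the number of cubes of `□_i` not yet reached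
  suffices h : ∀ (n : ℕ) (T : Finset ι), (Q \ T).card = n → i ∈ T → T ⊆ Q →
      (T \ E).card ≤ 1 + ∑ Y ∈ J₁.filter (fun Y => Y ∩ W ⊆ T), ((Y ∩ W).card - 1) →
      (Q \ E).card ≤ 1 + ∑ Y ∈ J₁.filter (fun Y => Y ∩ W ⊆ Q), ((Y ∩ W).card - 1) by
    refine h _ {i} rfl (mem_singleton_self i) (singleton_subset_iff.2 (mem_region_self hi)) ?_
    calc (({i} : Finset ι) \ E).card ≤ ({i} : Finset ι).card := card_le_card sdiff_subset
      _ = 1 := card_singleton i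
      _ ≤ 1 + _ := Nat.le_add_right 1 _
  intro n
  induction n using Nat.strong_induction_on with
  | _ n ih => ?_
  intro T hn hiT hTQ hinv
  have hTW : T ⊆ W := hTQ.trans (region_subset J W i)
  by_cases hcl : IsClosed J W T
  · -- a closed set containing `i` inside `□_i` is `□_i`
    have hTQ' : T = Q := region_connected hTQ hiT hcl
    rw [← hTQ']
    exact hinv
  · -- an expandable joining set: it meets `T` but has cubes of `W` outside `T`
    have hex : ∃ Y ∈ J, (Y ∩ T).Nonempty ∧ ¬ Y ∩ W ⊆ T := by
      by_contra hne
      push Not at hne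
      exact hcl hne
    obtain ⟨Y, hYJ, hYT, hnot⟩ := hex
    set T' := T ∪ Y ∩ W with hT'def
    have hYQ : Y ∩ W ⊆ Q := by
      obtain ⟨k, hk⟩ := hYT
      exact isClosed_region J W i Y hYJ ⟨k, mem_inter.2 ⟨(mem_inter.1 hk).1, hTQ (mem_inter.1 hk).2⟩⟩
    have hT'Q : T' ⊆ Q := union_subset hTQ hYQ
    have hTT' : T ⊆ T' := subset_union_left
    have hlt : (Q \ T').card < (Q \ T).card := by
      refine card_lt_card ⟨sdiff_subset_sdiff Subset.rfl hTT', fun hss => hnot ?_⟩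
      intro y hy
      by_contra hyT
      exact (mem_sdiff.1 (hss (mem_sdiff.2 ⟨hYQ hy, hyT⟩))).2 (mem_union_right _ hy)
    have hmono : ∑ Z ∈ J₁.filter (fun Z => Z ∩ W ⊆ T), ((Z ∩ W).card - 1) ≤
        ∑ Z ∈ J₁.filter (fun Z => Z ∩ W ⊆ T'), ((Z ∩ W).card - 1) :=
      sum_le_sum_of_subset_of_nonneg
        (fun Z hZ => mem_filter.2 ⟨(mem_filter.1 hZ).1, (mem_filter.1 hZ).2.trans hTT'⟩) fun _ _ _ => Nat.zero_le _
    refine ih _ (hn ▸ hlt) T' rfl (hTT' hiT) hT'Q ?_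
    by_cases hY1 : Y ∈ J₁
    · -- a small-factor join: at most `|Y ∩ W| − 1` new cubes, and `Y` is newly assigned
      have h1 : ((Y ∩ W) \ T).card ≤ (Y ∩ W).card - 1 := by
        obtain ⟨k, hk⟩ := hYT
        have hkYW : k ∈ Y ∩ W := mem_inter.2 ⟨(mem_inter.1 hk).1, hTW (mem_inter.1 hk).2⟩
        have hsub : (Y ∩ W) \ T ⊆ (Y ∩ W).erase k := by
          intro x hx
          obtain ⟨hxY, hxT⟩ := mem_sdiff.1 hx
          exact mem_erase.2 ⟨fun hxk => hxT (hxk ▸ (mem_inter.1 hk).2), hxY⟩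
        calc ((Y ∩ W) \ T).card ≤ ((Y ∩ W).erase k).card := card_le_card hsub
          _ = (Y ∩ W).card - 1 := card_erase_of_mem hkYW
      have hcard : (T' \ E).card ≤ (T \ E).card + ((Y ∩ W).card - 1) := by
        have hsub : T' \ E ⊆ (T \ E) ∪ ((Y ∩ W) \ T) := by
          intro x hx
          obtain ⟨hxT', hxE⟩ := mem_sdiff.1 hx
          by_cases hxT : x ∈ T
          · exact mem_union_left _ (mem_sdiff.2 ⟨hxT, hxE⟩)
          · rcases mem_union.1 hxT' with hxT'' | hxY
            · exact absurd hxT'' hxT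
            · exact mem_union_right _ (mem_sdiff.2 ⟨hxY, hxT⟩)
        calc (T' \ E).card ≤ ((T \ E) ∪ ((Y ∩ W) \ T)).card := card_le_card hsub
          _ ≤ (T \ E).card + ((Y ∩ W) \ T).card := card_union_le _ _
          _ ≤ (T \ E).card + ((Y ∩ W).card - 1) := Nat.add_le_add_left h1 _
      have hsum : ∑ Z ∈ J₁.filter (fun Z => Z ∩ W ⊆ T), ((Z ∩ W).card - 1) + ((Y ∩ W).card - 1) ≤
          ∑ Z ∈ J₁.filter (fun Z => Z ∩ W ⊆ T'), ((Z ∩ W).card - 1) := by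
        have hYnot : Y ∉ J₁.filter (fun Z => Z ∩ W ⊆ T) := fun h => hnot (mem_filter.1 h).2
        have hsub : insert Y (J₁.filter (fun Z => Z ∩ W ⊆ T)) ⊆ J₁.filter (fun Z => Z ∩ W ⊆ T') := by
          intro Z hZ
          rcases mem_insert.1 hZ with rfl | hZ
          · exact mem_filter.2 ⟨hY1, subset_union_right⟩
          · exact mem_filter.2 ⟨(mem_filter.1 hZ).1, (mem_filter.1 hZ).2.trans hTT'⟩
        calc ∑ Z ∈ J₁.filter (fun Z => Z ∩ W ⊆ T), ((Z ∩ W).card - 1) + ((Y ∩ W).card - 1)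
            = ∑ Z ∈ insert Y (J₁.filter (fun Z => Z ∩ W ⊆ T)), ((Z ∩ W).card - 1) := by
              rw [sum_insert hYnot, add_comm]
          _ ≤ _ := sum_le_sum_of_subset_of_nonneg hsub fun _ _ _ => Nat.zero_le _
      omega
    · -- any other join adds exceptional cubes only
      have hYE : Y ∩ W ⊆ E := fun x hx =>
        mem_biUnion.2 ⟨Y, mem_sdiff.2 ⟨hYJ, hY1⟩, (mem_inter.1 hx).1⟩
      have hcard : (T' \ E).card ≤ (T \ E).card := by
        refine card_le_card fun x hx => ?_
        obtain ⟨hxT', hxE⟩ := mem_sdiff.1 hx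
        rcases mem_union.1 hxT' with hxT | hxY
        · exact mem_sdiff.2 ⟨hxT, hxE⟩
        · exact absurd (hYE hxY) hxE
      omega

/-- with p. 303 *"Note that Y contains at most a few cubes"* (at most `c` cubes of `W` per small-factor joining set): the non-exceptional
cubes of `□_i` number at most `1 + (c − 1)·N(□_i)`, `N(□_i)` = the number of small-factor joining sets assigned to `□_i` (those with
`Y ∩ W ⊆ □_i`, as in `BIJ88ElementaryRegions304.prod_regroup`) — at least `(|□_i ∖ E| − 1)/(c − 1)` small factors.
[cite: BalabanImbrieJaffe1988, p.307 (Sect. 5.13)] -/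
theorem card_region_sdiff_le_mul (J J₁ : Finset (Finset ι)) (W : Finset ι) {i : ι} (hi : i ∈ W) {c : ℕ}
    (hc : ∀ Y ∈ J₁, (Y ∩ W).card ≤ c) :
    ((region J W i) \ (J \ J₁).biUnion id).card ≤ 1 + (c - 1) * (J₁.filter (fun Y => Y ∩ W ⊆ region J W i)).card := by
  refine (card_region_sdiff_le J J₁ W hi).trans (Nat.add_le_add_left ?_ 1)
  calc ∑ Y ∈ J₁.filter (fun Y => Y ∩ W ⊆ region J W i), ((Y ∩ W).card - 1)
      ≤ ∑ Y ∈ J₁.filter (fun Y => Y ∩ W ⊆ region J W i), (c - 1) :=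
        sum_le_sum fun Y hY => Nat.sub_le_sub_right (hc Y (mem_filter.1 hY).1) 1
    _ = (c - 1) * (J₁.filter (fun Y => Y ∩ W ⊆ region J W i)).card := by
        rw [sum_const, smul_eq_mul, mul_comm]

/-- the case without exceptional joining sets (`J₁ = J`): *"connected unions of □^{(α)}"* of `n` cubes glued by joining sets of at most `c`
cubes need at least `(n − 1)/(c − 1)` of them — `|□_i| ≤ 1 + (c − 1)·N(□_i)`. [cite: BalabanImbrieJaffe1988, p.307 (Sect. 5.13)] -/
theorem card_region_le_mul (J : Finset (Finset ι)) (W : Finset ι) {i : ι} (hi : i ∈ W) {c : ℕ} (hc : ∀ Y ∈ J, (Y ∩ W).card ≤ c) :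
    (region J W i).card ≤ 1 + (c - 1) * (J.filter (fun Y => Y ∩ W ⊆ region J W i)).card := by
  simpa only [sdiff_self, Finset.bot_eq_empty, biUnion_empty, sdiff_empty] using card_region_sdiff_le_mul J J W hi hc

/-- the count for a member of the decomposition `{□_i}`. [cite: BalabanImbrieJaffe1988, p.307 (Sect. 5.13)] -/
theorem card_sdiff_le_mul_of_mem_regions {J : Finset (Finset ι)} (J₁ : Finset (Finset ι)) {W P : Finset ι} (hP : P ∈ regions J W)
    {c : ℕ} (hc : ∀ Y ∈ J₁, (Y ∩ W).card ≤ c) :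
    (P \ (J \ J₁).biUnion id).card ≤ 1 + (c - 1) * (J₁.filter (fun Y => Y ∩ W ⊆ P)).card := by
  obtain ⟨i, hi, rfl⟩ := mem_regions.1 hP
  exact card_region_sdiff_le_mul J J₁ W hi hc

/-! ## §2 *"at least a small power of e^β(L^kε/ε₀)^{1/4−α} in every cube of X_α"*, exceptions aside -/

/-- a product of factors of modulus at most `θ` over a finite family has modulus at most `θ^{#family}`.
[cite: BalabanImbrieJaffe1988, p.307 (Sect. 5.13)] -/
theorem abs_prod_le_pow {κ : Type*} (s : Finset κ) (m : κ → ℝ) {θ : ℝ} (hm : ∀ Y ∈ s, |m Y| ≤ θ) :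
    |∏ Y ∈ s, m Y| ≤ θ ^ s.card := by
  rw [Finset.abs_prod]
  calc ∏ Y ∈ s, |m Y| ≤ ∏ _Y ∈ s, θ := prod_le_prod (fun _ _ => abs_nonneg _) hm
    _ = θ ^ s.card := prod_const θ

/-- **p. 307**: the small-factor joining sets assigned to `□_i` (each with a factor `m Y`, `|m Y| ≤ θ`: the `e^{−V^{(k)}(Y)} − 1`, the
`e^{−W₅^{(k)}(X)} − 1`) contribute at most `θ^{N(□_i)}` to `f(□_i)`. [cite: BalabanImbrieJaffe1988, p.307 (Sect. 5.13)] -/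
theorem abs_prod_assigned_le_pow (J₁ : Finset (Finset ι)) (W P : Finset ι) (m : Finset ι → ℝ) {θ : ℝ} (hm : ∀ Y ∈ J₁, |m Y| ≤ θ) :
    |∏ Y ∈ J₁.filter (fun Y => Y ∩ W ⊆ P), m Y| ≤ θ ^ (J₁.filter (fun Y => Y ∩ W ⊆ P)).card :=
  abs_prod_le_pow _ m fun Y hY => hm Y (mem_filter.1 hY).1

/-- **p. 307** [PDF 51], verbatim: *"Altogether, we typically get at least a small power of e^β(L^kε/ε₀)^{1/4−α} in every cube of X_α. The
exceptions are when cubes are in a component of Λ₁₁^{(k)c}, when they support some F^{m̄}_{k,loc}(X_{σ₁}), or when X_α is a single cube."* —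
PROVED for an elementary region: with `0 < θ ≤ 1` bounding the factor of every small-factor joining set and at most `c ≥ 2` cubes per such
set, the factors assigned to `□_i` have product of modulus at most `θ^{(|□_i ∖ E| − 1)/(c − 1)}` — the power `β′ = 1/(c − 1)` of `θ` for every
non-exceptional cube but one (`E` = the cubes of the rule-(iii)/(iv) joining sets: near an `X_{σ₁}`, or in a component of Λ₁₁^{(k)c}; the
"−1" is the single-cube exception). [cite: BalabanImbrieJaffe1988, p.307 (Sect. 5.13)] -/
theorem abs_prod_assigned_le_rpow (J J₁ : Finset (Finset ι)) (W : Finset ι) {i : ι} (hi : i ∈ W) {c : ℕ} (h2 : 2 ≤ c)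
    (hc : ∀ Y ∈ J₁, (Y ∩ W).card ≤ c) (m : Finset ι → ℝ) {θ : ℝ} (hθ : 0 < θ) (hθ1 : θ ≤ 1)
    (hm : ∀ Y ∈ J₁, |m Y| ≤ θ) :
    |∏ Y ∈ J₁.filter (fun Y => Y ∩ W ⊆ region J W i), m Y| ≤
      θ ^ (((((region J W i) \ (J \ J₁).biUnion id).card : ℝ) - 1) / ((c : ℝ) - 1)) := by
  refine (abs_prod_assigned_le_pow J₁ W (region J W i) m hm).trans ?_
  rw [← Real.rpow_natCast]
  apply Real.rpow_le_rpow_of_exponent_ge hθ hθ1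
  have hc1 : (1 : ℕ) ≤ c := le_trans (by norm_num) h2
  have hpos : (0 : ℝ) < (c : ℝ) - 1 := by
    have : ((2 : ℕ) : ℝ) ≤ (c : ℝ) := Nat.cast_le.2 h2
    push_cast at this
    linarith
  rw [div_le_iff₀ hpos]
  have hB := card_region_sdiff_le_mul J J₁ W hi hc
  have hcast : (((1 + (c - 1) * (J₁.filter (fun Y => Y ∩ W ⊆ region J W i)).card : ℕ) : ℝ)) =
      1 + ((c : ℝ) - 1) * ((J₁.filter (fun Y => Y ∩ W ⊆ region J W i)).card : ℝ) := by
    rw [Nat.cast_add, Nat.cast_mul, Nat.cast_sub hc1, Nat.cast_one]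
  have hB' : (((region J W i \ (J \ J₁).biUnion id).card : ℕ) : ℝ) ≤
      1 + ((c : ℝ) - 1) * ((J₁.filter (fun Y => Y ∩ W ⊆ region J W i)).card : ℝ) := by
    rw [← hcast]
    exact_mod_cast hB
  linarith

/-- the same bound for a member `P` of the decomposition `{□_i}` of `W`. [cite: BalabanImbrieJaffe1988, p.307 (Sect. 5.13)] -/
theorem abs_prod_assigned_le_rpow_of_mem_regions {J : Finset (Finset ι)} (J₁ : Finset (Finset ι)) {W P : Finset ι}
    (hP : P ∈ regions J W) {c : ℕ} (h2 : 2 ≤ c) (hc : ∀ Y ∈ J₁, (Y ∩ W).card ≤ c) (m : Finset ι → ℝ) {θ : ℝ} (hθ : 0 < θ)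
    (hθ1 : θ ≤ 1) (hm : ∀ Y ∈ J₁, |m Y| ≤ θ) :
    |∏ Y ∈ J₁.filter (fun Y => Y ∩ W ⊆ P), m Y| ≤ θ ^ ((((P \ (J \ J₁).biUnion id).card : ℝ) - 1) / ((c : ℝ) - 1)) := by
  obtain ⟨i, hi, rfl⟩ := mem_regions.1 hP
  exact abs_prod_assigned_le_rpow J J₁ W hi h2 hc m hθ hθ1 hm

/-- the printed shape *"(e^β(L^kε/ε₀)^{1/4−α})^{β′|X_α∖Λ₁₁^{(k)c}|}"* times a volume factor: with `β′ = 1/(c − 1)` the bound reads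
`θ^{−β′} · (θ^{β′})^{|□_i ∖ E|}` (`θ^{−β′} ≥ 1` is the single-cube volume factor *"we have to include … in our final estimate"*).
[cite: BalabanImbrieJaffe1988, p.307 (Sect. 5.13)] -/
theorem abs_prod_assigned_le_betaPrime (J J₁ : Finset (Finset ι)) (W : Finset ι) {i : ι} (hi : i ∈ W) {c : ℕ} (h2 : 2 ≤ c)
    (hc : ∀ Y ∈ J₁, (Y ∩ W).card ≤ c) (m : Finset ι → ℝ) {θ : ℝ} (hθ : 0 < θ) (hθ1 : θ ≤ 1)
    (hm : ∀ Y ∈ J₁, |m Y| ≤ θ) :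
    |∏ Y ∈ J₁.filter (fun Y => Y ∩ W ⊆ region J W i), m Y| ≤
      θ ^ (-(1 / ((c : ℝ) - 1))) * (θ ^ (1 / ((c : ℝ) - 1))) ^ ((region J W i) \ (J \ J₁).biUnion id).card := by
  refine (abs_prod_assigned_le_rpow J J₁ W hi h2 hc m hθ hθ1 hm).trans (le_of_eq ?_)
  rw [← Real.rpow_natCast, ← Real.rpow_mul hθ.le, ← Real.rpow_add hθ]
  congr 1
  ring

end Literature.MathematicalPhysics.QuantumFieldTheory.BalabanImbrieJaffe1984to88.BIJ88SmallPowerPerCube307
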